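import Literature.MathematicalPhysics.QuantumFieldTheory.SpeciesTimeReflection
import Literature.MathematicalPhysics.QuantumLattice.CloverPseudoscalarParity
import Literature.MathematicalPhysics.QuantumLattice.GaugeGroups
import HarnessLib

/-!
# `⟨Q⟩ = 0` exactly on every torus: the Wilson measure is time-reflection invariant, reflection-odd observables have zero mean, and the clover topological charge is reflection-odd

HONEST FRAMING: exact (Metropolis-corrected) sampling algorithms for lattice gauge theory;
figures of merit are autocorrelation/cost numbers at stated couplings and volumes; no
continuum-physics claim.

Venture `LatticeQCDFlow` (cell pub-lqcd), sub-topic `Scoring`; FANOUT row 16 (`su2-base`, the 4-d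
`SU(2)` baselines: heat bath + over-relaxation and HMC chains scored on `τ_int(Q)`, `Q` the clover
topological charge).  NEW WORK of the cell (placement rule) over the Literature's torus Wilson theory
(`ConstructiveQFTWave0`: `GaugeConfig d L G`, `wilsonAction ρ`, `wilsonMeasure ρ β`,
`wilsonExpectation`), its site time reflection `Θ' = GaugeConfig.negReflect`
(`ConstructiveQFTWave0SiteRPProofs`: `θ' (t, x⃗) = (−t, x⃗)`, temporal links traversed backwards), the
`Θ'`-INVARIANCE of `μ_{Λ,β}` on every torus (`SpeciesTimeReflection` (T1):
`wilsonMeasure_map_negReflect_eq`, `measurePreserving_negReflect_wilsonMeasure`; the measurable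
equivalence `WilsonSiteRP.negReflectEquiv` of `WilsonSiteRPForm`) and its clover pseudoscalar density
(`QuantumLattice.CloverPseudoscalar(Parity)`: `cloverPseudoscalar ρ x U = −¼ ε_{μνρσ} Re tr(C_{μν}C_{ρσ})`
with Lüscher's clover `C_{μν}`; odd under abstract time reflections, `cloverPseudoscalar_reflect`, whose
torus instantiation that file records as "checked, not imported").  Nothing here is cited as a fact; the
Literature definitions and theorems are used, not restated.  Printed counterparts, NAMED ONLY: the
folklore "the topological charge is a pseudoscalar, so `⟨Q⟩ = 0` by parity" used as a run check in
every topology measurement (Di Vecchia–Fabricius–Rossi–Veneziano 1981; Lüscher 2010 §3.2).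

## Why the cell wants it (value-free)

Row 16's acceptance list contains the sanity check "`⟨Q⟩ = 0` within `3σ`" for every scored chain, and
rows 17–24 score `τ_int(Q)` of flowed / cooled clover charges.  This file makes the check a THEOREM
about the TARGET: for every finite torus `(ℤ/L)^4`, every compact gauge group with a continuous unitary
matrix representation `ρ` (`SU(2)`, `SU(3)`, `U(1)`, …) and EVERY real `β`, the Wilson-measure mean of
the (bare, flow time `0`) clover charge `Q = Σ_x P_x` is exactly `0` — so a measured `⟨Q⟩ ≠ 0` beyond
errors indicts the sampler or the estimator, never the target, at every volume and coupling (no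
large-volume or continuum argument involved).

## What is proved (`L ≥ 1`, `G` compact with a continuous matrix representation `ρ`, `β ∈ ℝ`)

* §1 `integral_eq_zero_of_measurePreserving_odd` — abstract: a measure-preserving measurable
  equivalence `e` and an observable with `F ∘ e = −F` give `∫ F = 0` (Bochner, any real normed space,
  no integrability hypothesis: both sides are junk `0` together).
* §2 (every `d ≥ 1`) the additive unfolding lemmas of `Θ'` / `θ'` in the form the clover parity lemma
  consumes (`negReflect_apply_zero`, `negReflect_apply_of_ne`, `negReflect_add_single_zero`,
  `negReflect_add_single_of_ne`), and **`wilsonExpectation_eq_zero_of_negReflect_odd`**: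
  `F ∘ Θ' = −F ⇒ ⟨F⟩_{Λ,β} = 0` (from (T1) and §1).
* §3 (`d = 4`, unitary `ρ`) `cloverPseudoscalar_negReflect` — `P_x(Θ'U) = −P_{θ'x}(U)` on the torus;
  `sum_cloverPseudoscalar_negReflect` — the total clover charge `Q(U) = Σ_x P_x(U)` is `Θ'`-odd;
  **`wilsonExpectation_cloverCharge_eq_zero`** — `⟨Q⟩_{Λ,β} = 0`;
  `wilsonExpectation_cloverPseudoscalar_eq_zero_of_fixed` — `⟨P_x⟩ = 0` at every site of the two
  reflection hyperplanes; `wilsonExpectation_su_cloverCharge_eq_zero` — the `SU(N)` instance with the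
  fundamental representation (row 16: `N = 2`; rows 21–24: `N = 3`).

NOT CLAIMED: the same for the charge measured AFTER Wilson flow / cooling (needs the reflection
covariance of the flow map, not in the tree: `QuantumLattice/LatticeWilsonFlow.lean` lists lattice
symmetry covariance as "deliberately NOT here") — a sequel; `⟨P_x⟩ = 0` off the reflection hyperplanes
(needs lattice translation invariance of `μ_{Λ,β}`, not typed on the torus); anything about `⟨Q²⟩`,
`τ_int(Q)` or integer-valuedness (the clover charge is not an integer); any number.
-/

noncomputable section

open MeasureTheory
open Literature.MathematicalPhysics.QuantumFieldTheory
open Literature.MathematicalPhysics.QuantumLattice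

namespace Summit.Ventures.LatticeQCDFlow.Scoring

/-! ## §1 Odd observables of a measure-preserving equivalence integrate to zero -/

section Abstract

variable {α E : Type*} [MeasurableSpace α] [NormedAddCommGroup E] [NormedSpace ℝ E]

/-- **Odd observables integrate to zero.**  If the measurable equivalence `e` preserves `μ` and
`F (e x) = −F x` for every `x`, then `∫ F dμ = 0` (Bochner integral in any real normed space; if `F`
is not integrable both `∫ F` and `∫ F ∘ e` are the junk value `0`, so no integrability is assumed). -/
theorem integral_eq_zero_of_measurePreserving_odd {μ : Measure α} (e : α ≃ᵐ α)
    (he : MeasurePreserving e μ μ) {F : α → E} (hF : ∀ x, F (e x) = -F x) :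
    ∫ x, F x ∂μ = 0 := by
  have h : ∫ x, F (e x) ∂μ = ∫ x, F x ∂μ := he.integral_comp' F
  simp only [hF, integral_neg] at h
  have h2 : (2 : ℝ) • ∫ x, F x ∂μ = 0 := by
    rw [two_smul]
    nth_rewrite 1 [← h]
    exact neg_add_cancel _
  exact (smul_eq_zero.1 h2).resolve_left two_ne_zero

end Abstract

/-! ## §2 The site reflection `Θ'` in additive form; odd observables have zero Wilson mean -/

section Reflection

variable {d L : ℕ} [NeZero d] {G : Type*} [Group G]

/-- The temporal link of the reflected configuration is the reversed reflected temporal link: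
`(Θ'U)(x, 0) = U(θ'(x + e₀), 0)⁻¹` (definitional unfolding, in the additive form used by the
Literature's clover parity lemmas). -/
theorem negReflect_apply_zero (U : GaugeConfig d L G) (x : Site d L) :
    U.negReflect (x, 0) = (U ((x + Pi.single 0 1).negReflect, 0))⁻¹ := rfl

/-- Spatial links are carried along: `(Θ'U)(x, i) = U(θ'x, i)` for `i ≠ 0`. -/
theorem negReflect_apply_of_ne (U : GaugeConfig d L G) (x : Site d L) {i : Fin d} (hi : i ≠ 0) :
    U.negReflect (x, i) = U (x.negReflect, i) := by
  unfold GaugeConfig.negReflect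
  exact if_neg hi

/-- The site reflection reverses the temporal shift: `θ'(x + e₀) = θ'x − e₀`. -/
theorem negReflect_add_single_zero (x : Site d L) :
    (x + Pi.single 0 1).negReflect = x.negReflect - Pi.single 0 1 := by
  have h := WilsonSiteRP.negReflect_shift_shift (d := d) (L := L) x
  simp only [Site.shift] at h
  rw [← h, add_sub_cancel_right]

/-- The site reflection commutes with spatial shifts: `θ'(x + eᵢ) = θ'x + eᵢ`, `i ≠ 0`. -/
theorem negReflect_add_single_of_ne (x : Site d L) {i : Fin d} (hi : i ≠ 0) :
    (x + Pi.single i 1).negReflect = x.negReflect + Pi.single i 1 := by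
  have h := WilsonSiteRP.negReflect_shift_of_ne (d := d) (L := L) x hi
  simpa only [Site.shift] using h

end Reflection

section Torus

variable {d L N : ℕ} [NeZero d] [NeZero L]
variable {G : Type*} [Group G] [TopologicalSpace G] [IsTopologicalGroup G] [CompactSpace G]
  [MeasurableSpace G] [BorelSpace G]
variable (ρ : G →* Matrix (Fin N) (Fin N) ℂ)
variable {V : Type*} [NormedAddCommGroup V] [NormedSpace ℝ V]

/-- **Reflection-odd observables have zero mean**: if `F (Θ'U) = −F U` for every configuration `U`,
then `⟨F⟩_{Λ,β} = 0` for every real `β` (every `d ≥ 1`, `L ≥ 1`, compact `G`, continuous `ρ`; `F`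
vector-valued, no integrability needed).  The `Θ'`-invariance of `μ_{Λ,β}` is the Literature's
`measurePreserving_negReflect_wilsonMeasure` (`SpeciesTimeReflection`, (T1)). -/
theorem wilsonExpectation_eq_zero_of_negReflect_odd (hρ : Continuous ρ) (β : ℝ)
    {F : GaugeConfig d L G → V} (hF : ∀ U, F U.negReflect = -F U) :
    wilsonExpectation ρ β F = 0 := by
  unfold wilsonExpectation
  exact integral_eq_zero_of_measurePreserving_odd (WilsonSiteRP.negReflectEquiv (d := d) (L := L))
    (measurePreserving_negReflect_wilsonMeasure ρ hρ β) hF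

end Torus

/-! ## §3 The clover topological charge is reflection-odd, hence `⟨Q⟩ = 0` -/

section Clover

variable {L N : ℕ} [NeZero L]
variable {G : Type*} [Group G] [TopologicalSpace G] [IsTopologicalGroup G] [CompactSpace G]
  [MeasurableSpace G] [BorelSpace G]
variable (ρ : G →* Matrix (Fin N) (Fin N) ℂ)

omit [NeZero L] [TopologicalSpace G] [IsTopologicalGroup G] [CompactSpace G] [MeasurableSpace G]
  [BorelSpace G] in
/-- **The clover pseudoscalar density is odd under the torus site reflection**:
`P_x(Θ'U) = −P_{θ'x}(U)` for a unitary representation `ρ` — the Literature's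
`cloverPseudoscalar_reflect` with `θ = Site.negReflect`, `Θ = GaugeConfig.negReflect` on `(ℤ/L)^4`. -/
theorem cloverPseudoscalar_negReflect (hρu : ∀ g, ρ g ∈ Matrix.unitaryGroup (Fin N) ℂ)
    (x : Site 4 L) (U : GaugeConfig 4 L G) :
    cloverPseudoscalar ρ x U.negReflect = -cloverPseudoscalar ρ x.negReflect U :=
  cloverPseudoscalar_reflect ρ hρu (R := ZMod L) Site.negReflect negReflect_add_single_zero
    (fun y _ hi => negReflect_add_single_of_ne y hi) U U.negReflect (negReflect_apply_zero U)
    (fun y _ hi => negReflect_apply_of_ne U y hi) x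

omit [TopologicalSpace G] [IsTopologicalGroup G] [CompactSpace G] [MeasurableSpace G]
  [BorelSpace G] in
/-- **The total clover charge `Q(U) = Σ_x P_x(U)` of the torus is reflection-odd**: `Q(Θ'U) = −Q(U)`
(reindex the site sum by the involution `θ'`). -/
theorem sum_cloverPseudoscalar_negReflect (hρu : ∀ g, ρ g ∈ Matrix.unitaryGroup (Fin N) ℂ)
    (U : GaugeConfig 4 L G) :
    ∑ x : Site 4 L, cloverPseudoscalar ρ x U.negReflect = -∑ x : Site 4 L, cloverPseudoscalar ρ x U := by
  calc ∑ x : Site 4 L, cloverPseudoscalar ρ x U.negReflect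
      = ∑ x : Site 4 L, -cloverPseudoscalar ρ x.negReflect U :=
        Finset.sum_congr rfl fun x _ => cloverPseudoscalar_negReflect ρ hρu x U
    _ = -∑ x : Site 4 L, cloverPseudoscalar ρ x.negReflect U := Finset.sum_neg_distrib _
    _ = -∑ x : Site 4 L, cloverPseudoscalar ρ x U := by
        rw [Fintype.sum_equiv (Function.Involutive.toPerm (Site.negReflect (d := 4) (L := L))
          WilsonSiteRP.negReflect_negReflect) (fun x => cloverPseudoscalar ρ x.negReflect U)
          (fun x => cloverPseudoscalar ρ x U) fun x => rfl]

/-- **`⟨Q⟩_{Λ,β} = 0` exactly.**  For every torus `(ℤ/L)^4` (`L ≥ 1`), every compact gauge group `G`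
with a continuous unitary matrix representation `ρ` and EVERY real `β`, the Wilson-measure mean of
the total (bare) clover topological charge `Q = Σ_x P_x` (`P_x = cloverPseudoscalar ρ x`, the clover
`F F̃` density up to `1/(8π²)`) vanishes. -/
theorem wilsonExpectation_cloverCharge_eq_zero (hρ : Continuous ρ)
    (hρu : ∀ g, ρ g ∈ Matrix.unitaryGroup (Fin N) ℂ) (β : ℝ) :
    wilsonExpectation ρ β (fun U : GaugeConfig 4 L G => ∑ x : Site 4 L, cloverPseudoscalar ρ x U) = 0 :=
  wilsonExpectation_eq_zero_of_negReflect_odd ρ hρ β fun U => sum_cloverPseudoscalar_negReflect ρ hρu U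

/-- **`⟨P_x⟩_{Λ,β} = 0` at every site of the reflection hyperplanes** (`θ'x = x`, i.e. `2·x₀ = 0` in
`ℤ/L`): there the density itself is a reflection-odd observable. -/
theorem wilsonExpectation_cloverPseudoscalar_eq_zero_of_fixed (hρ : Continuous ρ)
    (hρu : ∀ g, ρ g ∈ Matrix.unitaryGroup (Fin N) ℂ) (β : ℝ) {x : Site 4 L} (hx : x.negReflect = x) :
    wilsonExpectation ρ β (fun U : GaugeConfig 4 L G => cloverPseudoscalar ρ x U) = 0 :=
  wilsonExpectation_eq_zero_of_negReflect_odd ρ hρ β fun U => by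
    rw [cloverPseudoscalar_negReflect ρ hρu, hx]

/-- **The `SU(N)` instance** (row 16: `N = 2`; the `SU(3)` rows: `N = 3`): for the Wilson theory of
`SU(N)` in its fundamental representation on `(ℤ/L)^4`, `⟨Q_clover⟩_{Λ,β} = 0` for every real `β` and
every `L ≥ 1`. -/
theorem wilsonExpectation_su_cloverCharge_eq_zero (n : ℕ) (β : ℝ) :
    wilsonExpectation (fundamentalRep (Fin n)) β
      (fun U : GaugeConfig 4 L (Matrix.specialUnitaryGroup (Fin n) ℂ) =>
        ∑ x : Site 4 L, cloverPseudoscalar (fundamentalRep (Fin n)) x U) = 0 :=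
  wilsonExpectation_cloverCharge_eq_zero (fundamentalRep (Fin n)) (continuous_fundamentalRep (Fin n))
    fundamentalRep_mem_unitaryGroup β

end Clover

end Summit.Ventures.LatticeQCDFlow.Scoring

end
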